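import Literature.LinearAlgebra.QuadraticForm.OrientationCharacter
import HarnessLib

/-!
# The determinant of a real isometry is the product of its two orientation characters:
# `det g = χ₊(g) · χ₋(g)` (Lester; Shirokov §5.1)

Topic `LinearAlgebra/QuadraticForm`, sequel of `QuadraticForm/OrientationCharacter` (the orientation
character `χ₊` of a real symmetric bilinear form `S`: `IsOrientationPreserving S g`, read at any positive
projection `P` as the sign of `det (posBlock P g)`, `posBlock P g = P g P + (1 − P)`) and
`QuadraticForm/OrientationCharacterProducts`. Written for lane `lit-hodgefound` (Track 2 foundations;
prover seat `lit-hodgefound-p18`, gen 48, row g48-#1, menu item "real-side `χ₊χ₋ = det`" of the gen 45–47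
close lines). THEOREMS ONLY — no definition, no named fact, no instance, no notation.

## Source, verbatim

D. S. Shirokov, *Clifford algebras and their applications to Lie groups and spinors*, Geometry,
Integrability and Quantization 19 (2018) 11–53 [`Shirokov2018CliffordLectures`; held text
`paper:arxiv-1709.06608`, §5.1 "Orthogonal Groups", p. 15]: "Let us consider pseudo-orthogonal group
`O(p,q)`, `p+q=n`: `O(p,q) := {A ∈ Mat(n,ℝ) : Aᵀ η A = η}`, `η = diag(1,…,1,−1,…,−1)`. It can be proved that
(for more details, see [Lester] and [msh3]) `A ∈ O(p,q) ⟹ det A = ±1`, `|A^{1…p}_{1…p}| ≥ 1`,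
`|A^{p+1…n}_{p+1…n}| ≥ 1`, `A^{1…p}_{1…p} = A^{p+1…n}_{p+1…n} / det A`, where `A^{1…p}_{1…p}` and
`A^{p+1…n}_{p+1…n}` are the minors of the matrix `A`. The group `O(p,q)` has the following subgroups:
`SO(p,q) := {A ∈ O(p,q) : det A = 1}`, `SO₊(p,q) := {A ∈ SO(p,q) : A^{1…p}_{1…p} ≥ 1} = {A ∈ SO(p,q) :
A^{p+1…n}_{p+1…n} ≥ 1} = {A ∈ O(p,q) : A^{1…p}_{1…p} ≥ 1, A^{p+1…n}_{p+1…n} ≥ 1}`,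
`O₊(p,q) := {A ∈ O(p,q) : A^{1…p}_{1…p} ≥ 1}`, `O₋(p,q) := {A ∈ O(p,q) : A^{p+1…n}_{p+1…n} ≥ 1}`. The
group `O(p,q)` has four components in the case `p ≠ 0`, `q ≠ 0` […] `O(p,q)/SO₊(p,q) = ℤ₂ × ℤ₂`."
(`[Lester]` = J. A. Lester, *Orthochronous subgroups of `O(p,q)`*, Linear and Multilinear Algebra 36
(1993) 111–113 [`Lester1993`].) D. Huybrechts, *Lectures on K3 surfaces*, Ch. 7 §5.4: "`O⁺(Λ) ⊂ O(Λ)`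
[…] the subgroup of all orthogonal transformations preserving any given orientation of the three positive
directions" (the companion file's `χ₊`).

## Rendering (coordinate-free)

In a basis adapted to a positive projection `P` (range `W` = the first `p` vectors, kernel `W^⊥` = the
last `q`), the minor `A^{1…p}_{1…p}` of `g` is `det (posBlock P g)` and the minor `A^{p+1…n}_{p+1…n}` is
`det (posBlock (1 − P) g)`; and `1 − P` is a positive projection of the form `−S` (§1, `IsPosProjection.one_sub`),
so that "`A^{p+1…n}_{p+1…n} > 0`" is the orientation character of `g` for `−S` — the character `χ₋` of the
NEGATIVE directions: `IsOrientationPreserving (−S) g`. Shirokov's `O₊ = O⁺(S)`, `O₋ = O⁺(−S)`.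

## Contents (all proved; Mathlib and the companion only)

* §1 `IsPosProjection.one_sub`: `1 − P` is a positive projection of `−S`; `sigNeg S` is its rank.
* §2 THE BLOCK IDENTITY (pure algebra: any idempotent `P`, any `g` with `g g' = 1`):
  `det g · det (posBlock (1 − P) g') = det (posBlock P g)` (`det_mul_det_posBlock_one_sub_of_mul_eq_one`), from
  the factorisations `posBlock P g · (1 + (1−P) g P) = 1 − P + g P` and
  `g · posBlock (1−P) g' = (1 − P + g P) · (1 − P g' (1−P))`, the two unipotent factors having determinant
  `1` (`det_one_add_mul_mul_mul_eq_one`: `det (1 + A f B) = 1` whenever `B A = 0`, by the block-triangular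
  determinant `LinearMap.det_eq_det_mul_det` along `range A`).
* §3 ADJOINTS: operators adjoint for a non-degenerate `S` have the same determinant
  (private `det_eq_det_of_forall_apply_eq`, via `S.toDual` and `LinearMap.det_dualMap`); an isometry `g` of a
  non-degenerate `S` is invertible (`exists_mul_eq_one_of_isometry`), is adjoint to its inverse, so
  `det g = det g⁻¹`, **`det g = ±1`** (`det_eq_one_or_eq_neg_one_of_isometry`, "`det A = ±1`"), and
  `det (posBlock (1−P) g⁻¹) = det (posBlock (1−P) g)`.
* §4 **THE MINOR IDENTITY** `det (posBlock P g) = det g · det (posBlock (1 − P) g)`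
  (`IsPosProjection.det_posBlock_eq_det_mul_det_posBlock_one_sub`; "`A^{1…p}_{1…p} = A^{p+1…n}_{p+1…n} / det A`"),
  the bounds `|det (posBlock P g)| ≥ 1` being out of scope; hence **`det g = χ₊(g) χ₋(g)`**:
  `0 < det g ↔ (IsOrientationPreserving S g ↔ IsOrientationPreserving (−S) g)`
  (`det_pos_iff_isOrientationPreserving_iff`, at a projection and unconditionally), the three descriptions of
  `SO₊ = O₊ ∩ SO = O₋ ∩ SO = O₊ ∩ O₋` (`isOrientationPreserving_and_neg_iff_and_det`, …), and `det g = 1` for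
  `g ∈ O₊ ∩ O₋`.
* §5 COROLLARIES: `det R_v = −1` for every reflection (`det_reflection`, directly by the block-triangular
  determinant along `ℝ v`), consistent with §4 (`χ₊(R_v) ⟺ S(v,v) < 0`, `χ₋(R_v) ⟺ S(v,v) > 0`:
  `isOrientationPreserving_neg_reflection_iff_pos`); `−1 ∈ O⁺(−S) ⟺ sigNeg S` even
  (`isOrientationPreserving_neg_neg_one_iff_even_sigNeg`).

NOT here: Lester's bounds `|A^{1…p}_{1…p}| ≥ 1`; the lattice reading `γ ∈ O⁺(L) ⟺ (γ ∈ O⁺(L(−1)) ⟺ det γ = 1)`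
(sequel, `Topology/FourManifolds`); the Clifford-algebra spinor norm.
-/

noncomputable section

namespace Literature.LinearAlgebra.QuadraticForm

open Module Set

variable {V : Type*} [NormedAddCommGroup V] [NormedSpace ℝ V]

/-- The determinant of a product of operators is the product of the determinants. [folklore] -/
private theorem det_mul_eq_det_mul_det (f g : V →L[ℝ] V) : (f * g).det = f.det * g.det :=
  LinearMap.det_comp _ _

/-- `det 1 = 1` for operators. [folklore] -/
private theorem det_one_eq_one : (1 : V →L[ℝ] V).det = 1 := by
  rw [ContinuousLinearMap.one_def, ContinuousLinearMap.det, ContinuousLinearMap.coe_id, LinearMap.det_id]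

/-! ### §1 The complementary projection `1 − P` is a positive projection of `−S` -/

/-- `(1 − P) x = x − P x`. [folklore] -/
private theorem one_sub_apply' (P : V →L[ℝ] V) (x : V) : (1 - P) x = x - P x := by
  rw [sub_apply, one_apply_eq_self]

namespace IsPosProjection

variable {S : LinearMap.BilinForm ℝ V} {P g g' : V →L[ℝ] V}

/-- **The complementary projection**: if `P` is a positive projection of `S` (range `W` maximal positive,
kernel `W^⊥`), then `1 − P` — range `W^⊥`, kernel `W` — is a positive projection of the form `−S`
(Shirokov's second block: the last `q = n₋` coordinates). [cite: Shirokov2018CliffordLectures, §5.1 (the minor `A^{p+1…n}_{p+1…n}`)] -/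
theorem one_sub (hP : IsPosProjection S P) : IsPosProjection (-S) (1 - P) := by
  refine ⟨?_, ?_, ?_, ?_⟩
  · ext x
    rw [mul_apply_eq_comp, one_sub_apply', one_sub_apply', map_sub, hP.apply_apply, sub_self, sub_zero]
  · intro x y
    simp only [LinearMap.neg_apply, one_sub_apply', map_sub, LinearMap.sub_apply, hP.selfAdjoint x y]
  · intro x hx hx0
    have hPx : P x = 0 := by
      rw [one_sub_apply', sub_eq_self] at hx
      exact hx
    have h := hP.neg x hPx hx0
    simp only [LinearMap.neg_apply]
    linarith
  · intro x hx hx0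
    have hPx : P x = x := by
      rw [one_sub_apply', sub_eq_zero] at hx
      exact hx.symm
    have h := hP.pos x hPx hx0
    simp only [LinearMap.neg_apply]
    linarith

variable [FiniteDimensional ℝ V]

/-- **The rank of the complementary projection is the negative index**: `sigNeg S = dim range (1 − P)`
(`= sigPos (−S)`, companion `sigPos_eq_finrank_range` for `−S`). [cite: Shirokov2018CliffordLectures, §5.1 (`p + q = n`)] -/
theorem sigNeg_eq_finrank_range_one_sub (hP : IsPosProjection S P) :
    sigNeg S.toQuadraticMap = finrank ℝ (LinearMap.range ((1 - P : V →L[ℝ] V) : V →ₗ[ℝ] V)) := by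
  rw [← _root_.sigPos_neg, show -S.toQuadraticMap = (-S).toQuadraticMap from rfl]
  exact hP.one_sub.sigPos_eq_finrank_range

end IsPosProjection

/-! ### §2 The block identity `det g · det (posBlock (1 − P) g⁻¹) = det (posBlock P g)` -/

section Block

variable {S : LinearMap.BilinForm ℝ V} {P g g' : V →L[ℝ] V}

/-- `posBlock P g · (1 + (1 − P) g P) = 1 − P + g P` (`P² = P`): the unipotent factor restores the
off-diagonal block `(1 − P) g P`. [cite: Shirokov2018CliffordLectures, §5.1] -/
theorem IsPosProjection.posBlock_mul_one_add (hP : IsPosProjection S P) (g : V →L[ℝ] V) :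
    posBlock P g * (1 + (1 - P) * g * P) = 1 - P + g * P := by
  ext x
  simp only [mul_apply_eq_comp, add_apply, one_apply_eq_self, sub_apply, map_add, map_sub, posBlock_apply,
    hP.apply_apply, sub_self]
  abel

/-- `g · posBlock (1 − P) g' = (1 − P + g P) · (1 − P g' (1 − P))` for `g g' = 1` and `P² = P`.
[cite: Shirokov2018CliffordLectures, §5.1] -/
theorem IsPosProjection.mul_posBlock_one_sub (hP : IsPosProjection S P) (hgg' : g * g' = 1) :
    g * posBlock (1 - P) g' = (1 - P + g * P) * (1 - P * g' * (1 - P)) := by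
  have hg1 : ∀ y, g (g' y) = y := fun y ↦ by rw [← mul_apply_eq_comp, hgg', one_apply_eq_self]
  ext x
  simp only [mul_apply_eq_comp, posBlock_apply, sub_apply, one_apply_eq_self, add_apply, map_sub, map_add,
    hP.apply_apply, hg1, sub_sub_cancel]
  abel

variable [FiniteDimensional ℝ V]

/-- **`det (1 + A f B) = 1` whenever `B A = 0`**: `N = A f B` has `N(range A) = 0` and `range N ⊆ range A`,
so `1 + N` is the identity on `range A` and on `V / range A` (block-triangular determinant,
`LinearMap.det_eq_det_mul_det`). [folklore] -/
private theorem det_one_add_mul_mul_mul_eq_one (A f B : V →L[ℝ] V) (hBA : B * A = 0) :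
    (1 + A * f * B).det = 1 := by
  set W : Submodule ℝ V := LinearMap.range (A : V →ₗ[ℝ] V) with hW
  set e : V →ₗ[ℝ] V := ((1 + A * f * B : V →L[ℝ] V) : V →ₗ[ℝ] V) with he
  have he_apply : ∀ x, e x = x + A (f (B x)) := fun x ↦ by
    simp only [he, ContinuousLinearMap.coe_coe, add_apply, one_apply_eq_self, mul_apply_eq_comp]
  have hBA' : ∀ y, B (A y) = 0 := fun y ↦ by rw [← mul_apply_eq_comp, hBA, zero_apply]
  have hmem : ∀ y, A y ∈ W := fun y ↦ ⟨y, rfl⟩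
  have hinv : ∀ x ∈ W, e x ∈ W := fun x hx ↦ by
    rw [he_apply]
    exact W.add_mem hx (hmem _)
  have hres : e.restrict hinv = LinearMap.id := by
    refine LinearMap.ext fun w ↦ Subtype.ext ?_
    obtain ⟨y, hy⟩ := w.2
    simp only [LinearMap.coe_restrict_apply, he_apply, LinearMap.id_coe, id_eq]
    rw [← hy, ContinuousLinearMap.coe_coe, hBA', map_zero, map_zero, add_zero]
  have hquot : W.mapQ W e hinv = LinearMap.id := by
    refine LinearMap.ext fun q ↦ ?_
    obtain ⟨x, rfl⟩ := Submodule.mkQ_surjective W q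
    simp only [Submodule.mkQ_apply, Submodule.mapQ_apply, LinearMap.id_coe, id_eq]
    refine (Submodule.Quotient.eq W).2 ?_
    rw [he_apply, add_sub_cancel_left]
    exact hmem _
  change LinearMap.det e = 1
  rw [LinearMap.det_eq_det_mul_det W e hinv, hres, hquot, LinearMap.det_id, LinearMap.det_id, mul_one]

/-- `det (1 + (1 − P) g P) = 1` (`P (1 − P) = 0`). [folklore] -/
private theorem IsPosProjection.det_one_add_one_sub_mul_mul (hP : IsPosProjection S P) (g : V →L[ℝ] V) :
    (1 + (1 - P) * g * P).det = 1 :=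
  det_one_add_mul_mul_mul_eq_one _ _ _ (by rw [mul_sub, mul_one, hP.idem, sub_self])

/-- `det (1 − P g' (1 − P)) = 1` (`(1 − P) P = 0`). [folklore] -/
private theorem IsPosProjection.det_one_sub_mul_mul_one_sub (hP : IsPosProjection S P) (g' : V →L[ℝ] V) :
    (1 - P * g' * (1 - P)).det = 1 := by
  have h : (1 : V →L[ℝ] V) - P * g' * (1 - P) = 1 + P * (-g') * (1 - P) := by noncomm_ring
  rw [h]
  exact det_one_add_mul_mul_mul_eq_one _ _ _ (by rw [sub_mul, one_mul, hP.idem, sub_self])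

/-- **The block identity** (any `g` with a right inverse `g'`, any positive — indeed any idempotent —
projection `P`): `det g · det (posBlock (1 − P) g') = det (posBlock P g)`, i.e. in adapted coordinates the
upper-left minor of `g` is `det g` times the lower-right minor of `g⁻¹`
(`g (Q g' Q + P) = (P g P + Q)(1 + Q g P)(1 − P g' Q)`, `Q = 1 − P`, with two unipotent factors).
[cite: Shirokov2018CliffordLectures, §5.1 (`A^{1…p}_{1…p} = A^{p+1…n}_{p+1…n} / det A`, first step)] -/
theorem IsPosProjection.det_mul_det_posBlock_one_sub_of_mul_eq_one (hP : IsPosProjection S P)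
    (hgg' : g * g' = 1) : g.det * (posBlock (1 - P) g').det = (posBlock P g).det := by
  have h1 := congrArg ContinuousLinearMap.det (hP.mul_posBlock_one_sub hgg')
  have h2 := congrArg ContinuousLinearMap.det (hP.posBlock_mul_one_add g)
  rw [det_mul_eq_det_mul_det, det_mul_eq_det_mul_det, hP.det_one_sub_mul_mul_one_sub, mul_one] at h1
  rw [det_mul_eq_det_mul_det, hP.det_one_add_one_sub_mul_mul, mul_one] at h2
  rw [h1, h2]

end Block

/-! ### §3 Adjoint operators have the same determinant; `det g = ±1` for an isometry -/

section Adjoint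

variable [FiniteDimensional ℝ V] {S : LinearMap.BilinForm ℝ V} {P f f' g g' : V →L[ℝ] V}

/-- **Adjoint operators have equal determinants**: if `S` is non-degenerate and `S(f x, y) = S(x, f' y)`
for all `x, y`, then `det f = det f'` — `f = Φ⁻¹ ∘ f'^* ∘ Φ` for `Φ = S^♯ : V ⥲ V^*`, and a transpose
has the same determinant (in coordinates `f' = η⁻¹ fᵀ η`). [folklore] -/
private theorem det_eq_det_of_forall_apply_eq (hnd : S.Nondegenerate) (h : ∀ x y, S (f x) y = S x (f' y)) :
    f.det = f'.det := by
  set Φ := S.toDual hnd with hΦ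
  have key : (f : V →ₗ[ℝ] V) =
      (Φ.symm : Module.Dual ℝ V →ₗ[ℝ] V) ∘ₗ (f' : V →ₗ[ℝ] V).dualMap ∘ₗ (Φ.symm.symm : V →ₗ[ℝ] Module.Dual ℝ V) := by
    refine LinearMap.ext fun x ↦ ?_
    rw [LinearMap.comp_apply, LinearMap.comp_apply, LinearEquiv.coe_coe, LinearEquiv.coe_coe,
      LinearEquiv.symm_symm, eq_comm, LinearEquiv.symm_apply_eq]
    refine LinearMap.ext fun y ↦ ?_
    rw [LinearMap.dualMap_apply, LinearMap.BilinForm.toDual_def, ContinuousLinearMap.coe_coe,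
      ContinuousLinearMap.coe_coe, LinearMap.BilinForm.toDual_def, h]
  change LinearMap.det (f : V →ₗ[ℝ] V) = LinearMap.det (f' : V →ₗ[ℝ] V)
  rw [key, LinearMap.det_conj, LinearMap.det_dualMap]

omit [FiniteDimensional ℝ V] in
/-- A form with a positive projection is non-degenerate (`S(x, ·) = 0 ⟹ x = 0` on `W ⊕ W^⊥`).
[cite: Huybrechts2016K3, Ch. 7 §5.4] -/
theorem IsPosProjection.nondegenerate (hP : IsPosProjection S P) (hS : S.IsSymm) : S.Nondegenerate :=
  (LinearMap.IsRefl.nondegenerate_iff_separatingLeft hS.isRefl).2 fun _ hx ↦ hP.eq_zero_of_forall hx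

/-- **An isometry of a non-degenerate form on a finite-dimensional space is invertible**: there is `g'`
with `g g' = 1 = g' g` (`g` is injective: `g x = 0 ⟹ S(x, y) = S(g x, g y) = 0` for all `y`).
[cite: Shirokov2018CliffordLectures, §5.1 (`O(p,q)` is a group)] -/
theorem exists_mul_eq_one_of_isometry (hnd : S.Nondegenerate) (hg : ∀ x y, S (g x) (g y) = S x y) :
    ∃ g' : V →L[ℝ] V, g * g' = 1 ∧ g' * g = 1 := by
  have hinj : Function.Injective (g : V →ₗ[ℝ] V) := by
    refine (injective_iff_map_eq_zero _).2 fun x hx ↦ hnd.1 x fun y ↦ ?_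
    rw [← hg, ContinuousLinearMap.coe_coe] at *
    rw [hx, map_zero, LinearMap.zero_apply]
  have hbij : Function.Bijective (g : V →ₗ[ℝ] V) := ⟨hinj, LinearMap.injective_iff_surjective.1 hinj⟩
  set e : V ≃L[ℝ] V := (LinearEquiv.ofBijective (g : V →ₗ[ℝ] V) hbij).toContinuousLinearEquiv with he
  have hecoe : ∀ x, e x = g x := fun _ ↦ rfl
  refine ⟨(e.symm : V →L[ℝ] V), ?_, ?_⟩
  · ext x
    rw [mul_apply_eq_comp, one_apply_eq_self, ContinuousLinearEquiv.coe_coe, ← hecoe, e.apply_symm_apply]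
  · ext x
    rw [mul_apply_eq_comp, one_apply_eq_self, ContinuousLinearEquiv.coe_coe, ← hecoe, e.symm_apply_apply]

omit [FiniteDimensional ℝ V] in
/-- An isometry and its inverse are adjoint: `S(g x, y) = S(x, g⁻¹ y)`. [folklore] -/
private theorem apply_eq_apply_inv_of_isometry (hg : ∀ x y, S (g x) (g y) = S x y) (hgg' : g * g' = 1)
    (x y : V) : S (g x) y = S x (g' y) := by
  conv_lhs => rw [← one_apply_eq_self (F := V →L[ℝ] V) y, ← hgg', mul_apply_eq_comp]
  rw [hg]

/-- **`det g = det g⁻¹` for an isometry** of a non-degenerate form (`g⁻¹` is the adjoint of `g`).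
[cite: Shirokov2018CliffordLectures, §5.1] -/
theorem det_eq_det_of_isometry_of_mul_eq_one (hnd : S.Nondegenerate) (hg : ∀ x y, S (g x) (g y) = S x y)
    (hgg' : g * g' = 1) : g.det = g'.det :=
  det_eq_det_of_forall_apply_eq hnd (apply_eq_apply_inv_of_isometry hg hgg')

/-- **`det A = ±1` for `A ∈ O(p,q)`**: an isometry of a non-degenerate symmetric form on a
finite-dimensional real space has determinant `1` or `−1` (`det g = det g⁻¹` and `det g · det g⁻¹ = 1`).
[cite: Shirokov2018CliffordLectures, §5.1 ("A ∈ O(p,q) ⟹ det A = ±1")] -/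
theorem det_eq_one_or_eq_neg_one_of_isometry (hnd : S.Nondegenerate) (hg : ∀ x y, S (g x) (g y) = S x y) :
    g.det = 1 ∨ g.det = -1 := by
  obtain ⟨g', hgg', -⟩ := exists_mul_eq_one_of_isometry hnd hg
  have h1 := det_eq_det_of_isometry_of_mul_eq_one hnd hg hgg'
  have h2 : g.det * g'.det = 1 := by rw [← det_mul_eq_det_mul_det, hgg', det_one_eq_one]
  rw [← h1] at h2
  exact mul_self_eq_one_iff.1 h2

/-- The determinant of an isometry of a non-degenerate form is non-zero. [cite: Shirokov2018CliffordLectures, §5.1] -/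
theorem det_ne_zero_of_isometry (hnd : S.Nondegenerate) (hg : ∀ x y, S (g x) (g y) = S x y) : g.det ≠ 0 := by
  rcases det_eq_one_or_eq_neg_one_of_isometry hnd hg with h | h <;> rw [h] <;> norm_num

/-- **The lower-right minors of `g` and `g⁻¹` agree**: `det (posBlock (1 − P) g') = det (posBlock (1 − P) g)`
for an isometry `g` with inverse `g'` — the two blocks are adjoint for `S` (`P`, `1 − P` self-adjoint,
`g⁻¹ = g^†`; in coordinates: the lower-right block of `g⁻¹ = η gᵀ η` is the transpose of that of `g`).
[cite: Shirokov2018CliffordLectures, §5.1] -/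
theorem IsPosProjection.det_posBlock_one_sub_eq_of_mul_eq_one (hP : IsPosProjection S P) (hS : S.IsSymm)
    (hg : ∀ x y, S (g x) (g y) = S x y) (hgg' : g * g' = 1) :
    (posBlock (1 - P) g').det = (posBlock (1 - P) g).det := by
  refine (det_eq_det_of_forall_apply_eq (f := posBlock (1 - P) g) (f' := posBlock (1 - P) g')
    (hP.nondegenerate hS) fun x y ↦ ?_).symm
  have hQ := hP.one_sub
  have hQadj : ∀ a b, S ((1 - P) a) b = S a ((1 - P) b) := fun a b ↦ by
    have h := hQ.selfAdjoint a b
    simp only [LinearMap.neg_apply, neg_inj] at h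
    exact h
  have hxQ : ∀ z, z - (1 - P) z = P z := fun z ↦ by rw [one_sub_apply', sub_sub_cancel]
  rw [posBlock_apply, posBlock_apply, hxQ, hxQ]
  simp only [map_add, LinearMap.add_apply]
  rw [hQadj, apply_eq_apply_inv_of_isometry hg hgg', hQadj, hP.selfAdjoint]

end Adjoint

/-! ### §4 The minor identity and `det g = χ₊(g) · χ₋(g)` -/

section Main

variable [FiniteDimensional ℝ V] {S : LinearMap.BilinForm ℝ V} {P g : V →L[ℝ] V}

namespace IsPosProjection

/-- **Lester–Shirokov minor identity, coordinate-free**: for an isometry `g` of the real symmetric form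
`S` and a positive projection `P`,
`det (posBlock P g) = det g · det (posBlock (1 − P) g)` — "`A^{1…p}_{1…p} = A^{p+1…n}_{p+1…n} / det A`"
(with `det A = ±1`). [cite: Shirokov2018CliffordLectures, §5.1] [cite: Lester1993, (cited there)] -/
theorem det_posBlock_eq_det_mul_det_posBlock_one_sub (hP : IsPosProjection S P) (hS : S.IsSymm)
    (hg : ∀ x y, S (g x) (g y) = S x y) :
    (posBlock P g).det = g.det * (posBlock (1 - P) g).det := by
  obtain ⟨g', hgg', -⟩ := exists_mul_eq_one_of_isometry (hP.nondegenerate hS) hg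
  rw [← hP.det_mul_det_posBlock_one_sub_of_mul_eq_one hgg', hP.det_posBlock_one_sub_eq_of_mul_eq_one hS hg hgg']

/-- The same identity solved for `det g`: `det g = det (posBlock P g) · det (posBlock (1 − P) g)` (both
minors being `±`-signed units is NOT used: `det g = ±1` inverts the factor). [cite: Shirokov2018CliffordLectures, §5.1] -/
theorem det_eq_det_posBlock_mul_det_posBlock_one_sub_div (hP : IsPosProjection S P) (hS : S.IsSymm)
    (hg : ∀ x y, S (g x) (g y) = S x y) :
    g.det = (posBlock P g).det / (posBlock (1 - P) g).det := by
  have hQ := hP.one_sub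
  have hgn : ∀ v, 0 < (-S) v v → 0 < (-S) (g v) (g v) := fun v hv ↦ by
    simp only [LinearMap.neg_apply] at hv ⊢
    rwa [hg]
  have hne : (posBlock (1 - P) g).det ≠ 0 := hQ.det_posBlock_ne_zero (hQ.pos_apply_of_forall_pos hgn)
  rw [hP.det_posBlock_eq_det_mul_det_posBlock_one_sub hS hg, mul_div_cancel_right₀ _ hne]

omit [FiniteDimensional ℝ V] in
/-- An isometry of `S` carries `(−S)`-positive vectors to `(−S)`-positive vectors. [folklore] -/
private theorem pos_apply_neg_of_isometry (hg : ∀ x y, S (g x) (g y) = S x y) :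
    ∀ v, 0 < (-S) v v → 0 < (-S) (g v) (g v) := fun v hv ↦ by
  simp only [LinearMap.neg_apply] at hv ⊢
  rwa [hg]

/-- **`det g = χ₊(g) · χ₋(g)`, read at a positive projection**: for an isometry `g`,
`0 < det g ⟺ (g ∈ O⁺(S) ⟺ g ∈ O⁺(−S))` — the determinant is positive iff the orientation characters of
the positive and of the negative directions agree ("`SO₊(p,q) = {A ∈ SO(p,q) : A^{1…p}_{1…p} ≥ 1} =
{A ∈ SO(p,q) : A^{p+1…n}_{p+1…n} ≥ 1} = {A ∈ O(p,q) : A^{1…p}_{1…p} ≥ 1, A^{p+1…n}_{p+1…n} ≥ 1}`").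
[cite: Shirokov2018CliffordLectures, §5.1] -/
theorem det_pos_iff_isOrientationPreserving_iff (hP : IsPosProjection S P) (hS : S.IsSymm)
    (hg : ∀ x y, S (g x) (g y) = S x y) :
    0 < g.det ↔ (IsOrientationPreserving S g ↔ IsOrientationPreserving (-S) g) := by
  have hQ := hP.one_sub
  have hgp := pos_apply_of_isometry hg
  have hgn := pos_apply_neg_of_isometry hg
  rw [hP.isOrientationPreserving_iff hS hgp, hQ.isOrientationPreserving_iff hS.neg hgn,
    hP.det_eq_det_posBlock_mul_det_posBlock_one_sub_div hS hg]
  have ha : (posBlock P g).det ≠ 0 := hP.det_posBlock_ne_zero (hP.pos_apply_of_forall_pos hgp)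
  have hb : (posBlock (1 - P) g).det ≠ 0 := hQ.det_posBlock_ne_zero (hQ.pos_apply_of_forall_pos hgn)
  rcases lt_or_gt_of_ne ha with ha' | ha' <;> rcases lt_or_gt_of_ne hb with hb' | hb'
  · exact ⟨fun _ ↦ ⟨fun h ↦ absurd h (not_lt.2 ha'.le), fun h ↦ absurd h (not_lt.2 hb'.le)⟩,
      fun _ ↦ div_pos_of_neg_of_neg ha' hb'⟩
  · exact ⟨fun h ↦ absurd h (not_lt.2 (div_neg_of_neg_of_pos ha' hb').le), fun h ↦ absurd (h.2 hb') (not_lt.2 ha'.le)⟩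
  · exact ⟨fun h ↦ absurd h (not_lt.2 (div_neg_of_pos_of_neg ha' hb').le), fun h ↦ absurd (h.1 ha') (not_lt.2 hb'.le)⟩
  · exact ⟨fun _ ↦ iff_of_true ha' hb', fun _ ↦ div_pos ha' hb'⟩

/-- **`det g = 1 ⟺ χ₊(g) = χ₋(g)`** for an isometry (`det g = ±1`). [cite: Shirokov2018CliffordLectures, §5.1] -/
theorem det_eq_one_iff_isOrientationPreserving_iff (hP : IsPosProjection S P) (hS : S.IsSymm)
    (hg : ∀ x y, S (g x) (g y) = S x y) :
    g.det = 1 ↔ (IsOrientationPreserving S g ↔ IsOrientationPreserving (-S) g) := by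
  rw [← hP.det_pos_iff_isOrientationPreserving_iff hS hg]
  rcases det_eq_one_or_eq_neg_one_of_isometry (hP.nondegenerate hS) hg with h | h <;> rw [h] <;> norm_num

/-- **`det g = −1 ⟺ χ₊(g) ≠ χ₋(g)`** for an isometry. [cite: Shirokov2018CliffordLectures, §5.1 (the components `O₊′`, `O₋′`)] -/
theorem det_eq_neg_one_iff_not_isOrientationPreserving_iff (hP : IsPosProjection S P) (hS : S.IsSymm)
    (hg : ∀ x y, S (g x) (g y) = S x y) :
    g.det = -1 ↔ ¬ (IsOrientationPreserving S g ↔ IsOrientationPreserving (-S) g) := by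
  rw [← hP.det_eq_one_iff_isOrientationPreserving_iff hS hg]
  rcases det_eq_one_or_eq_neg_one_of_isometry (hP.nondegenerate hS) hg with h | h <;> rw [h] <;> norm_num

/-- **`SO₊ = O₊ ∩ O₋ = O₊ ∩ SO`**: `g ∈ O⁺(S) ∧ g ∈ O⁺(−S) ⟺ g ∈ O⁺(S) ∧ det g = 1`.
[cite: Shirokov2018CliffordLectures, §5.1 ("SO₊(p,q) := {A ∈ SO(p,q) : A^{1…p}_{1…p} ≥ 1} = … = {A ∈ O(p,q) : A^{1…p}_{1…p} ≥ 1, A^{p+1…n}_{p+1…n} ≥ 1}")] -/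
theorem isOrientationPreserving_and_neg_iff_and_det (hP : IsPosProjection S P) (hS : S.IsSymm)
    (hg : ∀ x y, S (g x) (g y) = S x y) :
    IsOrientationPreserving S g ∧ IsOrientationPreserving (-S) g ↔ IsOrientationPreserving S g ∧ g.det = 1 := by
  rw [hP.det_eq_one_iff_isOrientationPreserving_iff hS hg]
  tauto

/-- **`SO₊ = O₋ ∩ SO`**: `g ∈ O⁺(S) ∧ g ∈ O⁺(−S) ⟺ g ∈ O⁺(−S) ∧ det g = 1`.
[cite: Shirokov2018CliffordLectures, §5.1 ("= {A ∈ SO(p,q) : A^{p+1…n}_{p+1…n} ≥ 1}")] -/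
theorem isOrientationPreserving_and_neg_iff_neg_and_det (hP : IsPosProjection S P) (hS : S.IsSymm)
    (hg : ∀ x y, S (g x) (g y) = S x y) :
    IsOrientationPreserving S g ∧ IsOrientationPreserving (-S) g ↔ IsOrientationPreserving (-S) g ∧ g.det = 1 := by
  rw [hP.det_eq_one_iff_isOrientationPreserving_iff hS hg]
  tauto

/-- **`χ₋` from `χ₊` and `det`**: `g ∈ O⁺(−S) ⟺ (g ∈ O⁺(S) ⟺ det g = 1)`.
[cite: Shirokov2018CliffordLectures, §5.1 (`A^{1…p}_{1…p} = A^{p+1…n}_{p+1…n} / det A`)] -/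
theorem isOrientationPreserving_neg_iff_iff_det (hP : IsPosProjection S P) (hS : S.IsSymm)
    (hg : ∀ x y, S (g x) (g y) = S x y) :
    IsOrientationPreserving (-S) g ↔ (IsOrientationPreserving S g ↔ g.det = 1) := by
  rw [hP.det_eq_one_iff_isOrientationPreserving_iff hS hg]
  tauto

end IsPosProjection

/-- **`det g = χ₊(g) · χ₋(g)`, unconditionally**: for a non-degenerate symmetric `S` on a
finite-dimensional real space and an isometry `g`, `0 < det g ⟺ (g ∈ O⁺(S) ⟺ g ∈ O⁺(−S))`.
[cite: Shirokov2018CliffordLectures, §5.1] [cite: Lester1993, (cited there)] -/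
theorem det_pos_iff_isOrientationPreserving_iff (hS : S.IsSymm) (hnd : S.Nondegenerate)
    (hg : ∀ x y, S (g x) (g y) = S x y) :
    0 < g.det ↔ (IsOrientationPreserving S g ↔ IsOrientationPreserving (-S) g) := by
  obtain ⟨P, hP⟩ := exists_isPosProjection hS hnd
  exact hP.det_pos_iff_isOrientationPreserving_iff hS hg

/-- `det g = 1 ⟺ (g ∈ O⁺(S) ⟺ g ∈ O⁺(−S))`, unconditionally. [cite: Shirokov2018CliffordLectures, §5.1] -/
theorem det_eq_one_iff_isOrientationPreserving_iff (hS : S.IsSymm) (hnd : S.Nondegenerate)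
    (hg : ∀ x y, S (g x) (g y) = S x y) :
    g.det = 1 ↔ (IsOrientationPreserving S g ↔ IsOrientationPreserving (-S) g) := by
  obtain ⟨P, hP⟩ := exists_isPosProjection hS hnd
  exact hP.det_eq_one_iff_isOrientationPreserving_iff hS hg

/-- `g ∈ O⁺(−S) ⟺ (g ∈ O⁺(S) ⟺ det g = 1)`, unconditionally: the character of the negative directions is
determined by that of the positive directions and the determinant. [cite: Shirokov2018CliffordLectures, §5.1] -/
theorem isOrientationPreserving_neg_iff_iff_det (hS : S.IsSymm) (hnd : S.Nondegenerate)
    (hg : ∀ x y, S (g x) (g y) = S x y) :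
    IsOrientationPreserving (-S) g ↔ (IsOrientationPreserving S g ↔ g.det = 1) := by
  obtain ⟨P, hP⟩ := exists_isPosProjection hS hnd
  exact hP.isOrientationPreserving_neg_iff_iff_det hS hg

/-- **`g ∈ O⁺(S) ∩ O⁺(−S) ⟹ det g = 1`** (`SO₊ ⊂ SO`). [cite: Shirokov2018CliffordLectures, §5.1] -/
theorem det_eq_one_of_isOrientationPreserving_of_neg (hS : S.IsSymm) (hnd : S.Nondegenerate)
    (hg : ∀ x y, S (g x) (g y) = S x y) (hpos : IsOrientationPreserving S g)
    (hneg : IsOrientationPreserving (-S) g) : g.det = 1 :=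
  (det_eq_one_iff_isOrientationPreserving_iff hS hnd hg).2 (iff_of_true hpos hneg)

end Main

/-! ### §5 Corollaries: reflections, `−1` -/

section Corollaries

variable [FiniteDimensional ℝ V] {S : LinearMap.BilinForm ℝ V} {P g : V →L[ℝ] V} {v : V}

/-- **A reflection has determinant `−1`**: `R_v(x) = x − (2 S(x,v)/S(v,v)) v` (`S(v,v) ≠ 0`) is `−1` on the
invariant line `ℝ v` and the identity on `V/ℝ v` (block-triangular determinant). No non-degeneracy needed.
[cite: Shirokov2018CliffordLectures, §5.1 ("O₋′(p,q) = R(x) SO₊(p,q)", reflections have det −1)] [cite: Huybrechts2016K3, Ch. 7 §5.4 (s_δ)] -/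
theorem det_reflection (hv : S v v ≠ 0) (hgv : ∀ x, g x = x - (2 / S v v * S x v) • v) : g.det = -1 := by
  have hv0 : v ≠ 0 := fun h ↦ hv (by rw [h]; simp)
  set W : Submodule ℝ V := ℝ ∙ v with hW
  set e : V →ₗ[ℝ] V := ((g : V →L[ℝ] V) : V →ₗ[ℝ] V) with he
  have he_apply : ∀ x, e x = x - (2 / S v v * S x v) • v := fun x ↦ by
    rw [he, ContinuousLinearMap.coe_coe, hgv]
  have hinv : ∀ x ∈ W, e x ∈ W := fun x hx ↦ by
    rw [he_apply]
    exact W.sub_mem hx (W.smul_mem _ (Submodule.mem_span_singleton_self v))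
  have hev : e v = (-1 : ℝ) • v := by
    rw [he_apply]
    have h2 : 2 / S v v * S v v = 2 := div_mul_cancel₀ 2 hv
    rw [h2]
    module
  have hres : e.restrict hinv = (-1 : ℝ) • LinearMap.id := by
    refine LinearMap.ext fun w ↦ Subtype.ext ?_
    obtain ⟨c, hc⟩ := Submodule.mem_span_singleton.1 w.2
    simp only [LinearMap.coe_restrict_apply, LinearMap.smul_apply, LinearMap.id_coe, id_eq,
      Submodule.coe_smul_of_tower]
    rw [← hc, map_smul, hev, smul_comm]
  have hquot : W.mapQ W e hinv = LinearMap.id := by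
    refine LinearMap.ext fun q ↦ ?_
    obtain ⟨x, rfl⟩ := Submodule.mkQ_surjective W q
    simp only [Submodule.mkQ_apply, Submodule.mapQ_apply, LinearMap.id_coe, id_eq]
    refine (Submodule.Quotient.eq W).2 ?_
    rw [he_apply, sub_sub_cancel_left]
    exact W.neg_mem (W.smul_mem _ (Submodule.mem_span_singleton_self v))
  have hfr : finrank ℝ W = 1 := finrank_span_singleton hv0
  change LinearMap.det e = -1
  rw [LinearMap.det_eq_det_mul_det W e hinv, hres, hquot, LinearMap.det_smul, LinearMap.det_id,
    LinearMap.det_id, mul_one, mul_one, hfr, pow_one]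

/-- **The two characters of a reflection disagree** (consistent with `det R_v = −1`): at a positive
projection `P`, `R_v ∈ O⁺(−S) ⟺ 0 < S(v,v)` — a reflection in a positive vector preserves the orientation
of the negative directions and reverses that of the positive ones, and vice versa
(companion: `R_v ∈ O⁺(S) ⟺ S(v,v) < 0`). [cite: Huybrechts2016K3, Ch. 7 §5.4 ("+1 if (δ)² < 0 and −1 otherwise")] [cite: Shirokov2018CliffordLectures, §5.1] -/
theorem IsPosProjection.isOrientationPreserving_neg_reflection_iff_pos (hP : IsPosProjection S P)
    (hS : S.IsSymm) (hv : S v v ≠ 0) (hgv : ∀ x, g x = x - (2 / S v v * S x v) • v) :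
    IsOrientationPreserving (-S) g ↔ 0 < S v v := by
  have hg := apply_reflection_apply_reflection hS hv hgv
  rw [hP.isOrientationPreserving_neg_iff_iff_det hS hg, det_reflection hv hgv]
  rcases lt_or_gt_of_ne hv with h | h
  · have hplus : IsOrientationPreserving S g := isOrientationPreserving_reflection_of_neg hS h hgv
    constructor
    · intro H; exact absurd (H.1 hplus) (by norm_num)
    · intro H; exact absurd h (not_lt.2 H.le)
  · have hplus : ¬ IsOrientationPreserving S g := not_isOrientationPreserving_reflection_of_pos hP hS h hgv
    exact ⟨fun _ ↦ h, fun _ ↦ ⟨fun H ↦ absurd H hplus, fun H ↦ absurd H (by norm_num)⟩⟩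

/-- `R_v ∈ O⁺(−S) ⟺ 0 < S(v,v)`, unconditionally (`S` non-degenerate symmetric).
[cite: Huybrechts2016K3, Ch. 7 §5.4] [cite: Shirokov2018CliffordLectures, §5.1] -/
theorem isOrientationPreserving_neg_reflection_iff_pos (hS : S.IsSymm) (hnd : S.Nondegenerate)
    (hv : S v v ≠ 0) (hgv : ∀ x, g x = x - (2 / S v v * S x v) • v) :
    IsOrientationPreserving (-S) g ↔ 0 < S v v := by
  obtain ⟨P, hP⟩ := exists_isPosProjection hS hnd
  exact hP.isOrientationPreserving_neg_reflection_iff_pos hS hv hgv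

/-- **`−1 ∈ O⁺(−S) ⟺ n₋ = sigNeg S` is even** (the companion's `−1 ∈ O⁺(S) ⟺ sigPos S` even, for `−S`;
together: `det(−1) = (−1)^{n₊+n₋}`). [cite: Huybrechts2016K3, Ch. 7 §5.4 Thm. 5.7] [cite: Shirokov2018CliffordLectures, §5.1] -/
theorem isOrientationPreserving_neg_neg_one_iff_even_sigNeg (hS : S.IsSymm) (hnd : S.Nondegenerate) :
    IsOrientationPreserving (-S) (-1 : V →L[ℝ] V) ↔ Even (sigNeg S.toQuadraticMap) := by
  obtain ⟨P, hP⟩ := exists_isPosProjection hS hnd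
  rw [hP.one_sub.isOrientationPreserving_neg_one_iff hS.neg, show (-S).toQuadraticMap = -S.toQuadraticMap from rfl,
    _root_.sigPos_neg]

end Corollaries

end Literature.LinearAlgebra.QuadraticForm
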